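import Mathlib
import HarnessLib
import HarnessLib.Audit
import Summits.CriticalPhenomena.Statement
import Literature.Probability.RandomPlanarGeometry.SLEConvergenceCriterion
import Literature.Probability.RandomPlanarGeometry.CurveTortuosity
import Summits.CriticalPhenomena.SAWScalingLimit.Theorems.SAWLeftRightFKGTraversalBoundTight
import HarnessLib.Audit.Status.Attr

/-!
Route: SAWTotalPositivity

DORMANT since 2026-08-26T05:02:35Z (reconciler: no traction for 8.4 d (last activity item-evidence-added at 2026-08-17T19:24:59Z); parked, not closed — `ledger route dormant route-CriticalPhenomena-SAWTotalPositivity --off` to reactivat) — unstaffed, not closed; items shared with open routes are served there. `ledger route dormant <id> --off` reactivates.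

# Route SAWTotalPositivity — nested beats crossing at x_c — total positivity of the SAW boundary
kernel as the a-priori engine for precompactness

It suffices to show X_TP = (TP) ∧ (B) ∧ (E) ∧ (I) [route realising idea card
totally-positive-polymer — "the polymer is totally positive"]:
 (TP) BoundaryTP2: the critical square-lattice SAW boundary kernel Z(u,v) = Σ_{γ:u→v} x_c^{|γ|}
(mass of Literature.Probability.RandomPlanarGeometry.SAW.weight) of every bounded simply connected
lattice domain is circular-TP₂ — for boundary points in cyclic order the CROSSING pairing weighs at
most each NON-CROSSING pairing, Z(p₁,p₃)Z(p₂,p₄) ≤ Z(p₁,p₂)Z(p₃,p₄); typed intrinsically (no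
contour): "every SAW p₁→p₃ meets every SAW p₂→p₄, and both non-crossing pairings are realisable by
disjoint SAWs"; reverse Simon–Lieb and boundary Harnack/MLR are its instances by relabelling;
 (B) CriticalBubbleBound: the critical bubble is finite — Z_Ω(u,v) ≤ C < ∞ for lattice-adjacent u, v
uniformly over bounded lattice domains (the one absolute constant TP cannot supply; substance of
G_{z_c}(0,e₁) < ∞ in d = 2);
 (E) TPToTraversalBound: (TP) + (B) ⇒ the Aizenman–Burchard hypothesis (H1) for the chordal critical
SAW (SAWTraversalBound, shared stmt-CriticalPhenomena-1880);
 (I) SubseqIdentification (shared stmt-CriticalPhenomena-0783).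
Then the PROVED AB criterion (TraversalBoundTight, shared stmt-1882 → EventualTight stmt-1881) and
the Prokhorov criterion give SAWScalingLimit.
Lean: `BoundaryTP2 ∧ CriticalBubbleBound ∧ TPToTraversalBound ∧ SubseqIdentification`

## Assembly
Pure logic down to the last step: TPToTraversalBound applied to BoundaryTP2 and CriticalBubbleBound
gives SAWTraversalBound; TraversalBoundTight gives EventualTight; for each (D, a, b) with
IsEndpointApprox the SAW laws are probability measures for all small δ (IsEndpointApprox.reachable ⇒
weight univ ≠ 0; finitely many SAWs in bounded Ω_δ ⇒ ≠ ∞), so after replacing law by a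
probability-valued family with the same germ at 0+ the PROVED Prokhorov criterion
Literature.Probability.RandomPlanarGeometry.convergesInLawToSLE_of_isTightAlongMesh (huniq :=
IsSLECurve.map_eq_holds, hY := SAW.aemeasurable_curve, hT := EventualTight, hL :=
SubseqIdentification through IsSubseqLimitLaw) yields ConvergesInLawToSLE (8/3), i.e.
SAWScalingLimit = Literature.Probability.RandomPlanarGeometry.SAW.SAWScalingLimit (same closing step
as SAWLeftRightFKG.Assembly).

Rationale: WHY THIS LINE. Mechanism: a SIGN STRUCTURE of the boundary kernel rather than an observable or an
association — TP₂ is log-supermodularity of (u,v) ↦ Z(u,v) in the cyclic boundary order ("two thin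
polymers prefer the nested pairing to the crossing one"), and by relabelling it already contains the
reverse Simon–Lieb inequality Z(a,c⁺)Z(c⁻,b) ≤ Z(c⁻,c⁺)Z(a,b) and the tip-uniform boundary Harnack
comparability Z(t,b) ≤ [Z(b,b⁺)/Z(b',b⁺)]·Z(t,b') in every slit domain — exactly the O(1)-loss
lower-gluing / bounded-density inputs that the precompactness and screening cards
(constant-loss-saw-comparison E2, circle-bridge-screening S2, brownian-domination-simple-limits'
reduction of BD) postulate, here derived from one inequality plus one absolute constant (the bubble,
MadrasSlade1993 p.22). Imported area: total positivity and circular planar networks (Karlin1968,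
GantmacherKrein2002, KarlinMcgregor1959, Fomin2001: for planar MARKOV kernels the circular minor
equals a non-intersection weight; doi:10.1016/s0024-3795(98)10087-3 Curtis–Ingerman–Morrow,
doi:10.1007/bf02566413 Colin de Verdière–Gitler–Vertigan, doi:10.1137/140997798 Kenyon–Wilson: TP of
all orders ⟺ response kernel of a circular planar resistor network — the card's exact "electrical
shadow"), with the planar-Ising precedent doi:10.1007/s10955-016-1690-x (Lis: boundary spin
correlations are TP) / doi:10.1215/00127094-2019-0086 (Galashin–Pylyavskyy), and AB/KS
precompactness (AizenmanBurchardDuke1999, KemppainenSmirnov2017). What it does that the other routes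
do not: SAWLeftRightFKG uses ONE polymer's association in the left–right order; this line uses a
TWO-polymer non-crossing inequality between DIFFERENT endpoints, exposes the critical bubble as an
explicit crux (silently assumed by several cards), files the Harnack output as a shareable typed
statement, and records where the structure theory stops: separated TP₃ fails at slit mouths (opening
session's enumeration) and, on strip rectangles, the separated circular minor of order k = rows + 1
is NEGATIVE at x_c (refuter rreview-6d2977b1, certified in exact arithmetic on the proved
μ-interval: k = 4 on 7×3, 8×3, 10×3; k = 5 on 10×4, 11×4; evidence files on
stmt-CriticalPhenomena-7118) — so no all-orders / electrical-shadow statement is kept (CircularTPAll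
dropped, rev 5) and the line rests on TP₂ alone.

RANKED CRUXES. #2 BoundaryTP2 (crux) — circular TP₂ of the critical SAW boundary kernel (card
Conjecture TP, order 2): for every bounded simply connected Ω ⊂ ℂ, δ > 0 and lattice points
p₁,p₂,p₃,p₄ of Ω_δ such that every SAW p₁→p₃ meets every SAW p₂→p₄ (interlacing) while the pairings
(p₁p₂|p₃p₄) and (p₁p₄|p₂p₃) are realisable by vertex-disjoint SAWs, Z(p₁,p₃)·Z(p₂,p₄) ≤
Z(p₁,p₂)·Z(p₃,p₄) (Z = SAW.weight … univ at x_c). The other non-crossing inequality, reverse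
Simon–Lieb and boundary Harnack are instances by relabelling. [difficulty: L] (why it might fail:
Enumeration evidence only (card: boxes ≤ 7×6; here 20 domains ≤ 38 sites incl. L-shapes and slit
boxes, 0 violations); across a bottleneck the 2×2 block is nearly rank one and the x_c-margin decays
geometrically with slit depth (2e-5, 4e-6, 9e-7 at depth 3,4,5); no switching lemma is known.)
[Summits/CriticalPhenomena/SAWScalingLimit/Ideas/totally-positive-polymer.md,
doi:10.1007/s10955-016-1690-x, doi:10.1215/00127094-2019-0086, Fomin2001, KarlinMcgregor1959,
MadrasSlade1993]
#3 TPToTraversalBound (crux) — the engine run — BoundaryTP2 → CriticalBubbleBound →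
SAWTraversalBound: cross-ratio positivity of the boundary kernel in every slit domain (domain
Markov: the future of the chordal SAW is the x_c-SAW of the slit graph from a boundary tip) plus one
bubble constant give the Aizenman–Burchard hypothesis (H1) — a shell-dependent threshold k(x,ρ,R),
K, λ > 2, δ₀ with P_δ(k separate traversals of D(x;ρ,R)) ≤ K(ρ/R)^λ. Scheme: reverse Simon–Lieb
lower gluing along the boundary of the slit domain + Simon–Lieb upper splitting at annulus crossings
+ Kesten's bridge-mass identity at x_c and D₄ symmetry for the scale-invariant ε, iterated over
dyadic annuli; endpoint bookkeeping as in
Literature.Probability.Percolation.bondExploration_traversalBound. [deps: BoundaryTP2,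
CriticalBubbleBound] [difficulty: XL] (why it might fail: TP yields two-polymer cross-ratio
inequalities and O(1) boundary gluing only; the ε against unforced annulus crossings needs a
scale-invariant bound comparing boundary-hugging with annulus-crossing partition functions — the RSW
gap (KS G2 unverified for SAW, false for κ>4 analogues).) [AizenmanBurchardDuke1999,
KemppainenSmirnov2017, Kesten1963SAW, MadrasSlade1993, KohlerSchindlerTassion2023,
DuminilCopinHammond2013,
Summits/CriticalPhenomena/SAWScalingLimit/Ideas/constant-loss-saw-comparison.md]
#4 CriticalBubbleBound (crux) — finiteness of the critical bubble in d = 2: there is C < ∞ with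
Z_Ω(u,v) = SAW.weight Ω δ u v univ ≤ C for every bounded Ω ⊂ ℂ, δ > 0 and lattice-adjacent u ∼ v
(equivalently, by monotone exhaustion, G_{z_c}(0,e₁) < ∞ on ℤ²). It is the absolute constant in
reverse Simon–Lieb Z(a,b) ≥ Z(a,c⁺)Z(c⁻,b)/Z(c⁻,c⁺) and in TPToHarnack. [difficulty: open-problem]
(why it might fail: In substance G_{z_c}(0,e₁)<∞ on ℤ², open since Madras–Slade 1993 p.22 ("not yet
proved that G_{z_c}(0,x) is even finite for d=2,3,4"); Hammond (doi:10.1214/17-aop1182) gives p_n ≤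
n^{-3/2+o(1)}μ^n on a density-one set, short of Σ_n n·p_n·μ^{-n} < ∞ (truth: n^{-5/2}).)
[MadrasSlade1993, doi:10.1214/17-aop1182, doi:10.1214/14-aop993, BDGS2012]
#6 SubseqIdentification (crux) — identification of subsequential limits (verbatim the shared item
stmt-CriticalPhenomena-0783 of routes SAWParafermion / SAWLeftRightFKG): for every Dobrushin domain,
endpoint approximation, sequence s_n → 0+ and probability measure μ on CurveClass ℂ that is the weak
limit of the SAW laws along s_n, μ is the chordal SLE_{8/3} law in D. Not this route's mechanism (TP
is embedding-blind); staffed through the routes that own it. [difficulty: open-problem] (why it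
might fail: Unconditional over arbitrary subsequential μ: SLE_{8/3} is known only IF the limit is
conformally covariant (LSW04 Prediction 1); on ℤ² no embedding-sensitive input exists (observable
open even on Hex); embedding-blind inputs incl. TP cannot give rotations (Beffara).)
[LawlerSchrammWerner2004SAW, LawlerSchrammWerner2003Restriction, DuminilCopinSmirnov2012,
Beffara2008Universal, Literature.Barriers.CriticalPhenomena.EmbeddingModulusUniqueness]
#9 BoundaryHarnack (support) — the engine's typed output, shareable — tip-uniform boundary Harnack
comparability of the critical SAW kernel: one C < ∞ such that in every bounded simply connected
lattice domain, for consecutive domain-adjacent boundary points b' ∼ b ∼ c and every t with {t,b}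
interlacing {b',c} (non-crossing pairings disjointly realisable), Z(t,b) ≤ C·Z(t,b'). Moving the
target one lattice step costs O(1) uniformly in the source and in the domain (incl. slit domains
with a fractal past): the bounded-density input (BP)/G1/S2 of cards restriction-markov-rigidity,
circle-bridge-screening, constant-loss-saw-comparison. [difficulty: L] [KennedyLawler2013,
Summits/CriticalPhenomena/SAWScalingLimit/Ideas/circle-bridge-screening.md,
Summits/CriticalPhenomena/SAWScalingLimit/Ideas/constant-loss-saw-comparison.md]
#9 TPToHarnack (support) — glue, provable now: BoundaryTP2 → CriticalBubbleBound → BoundaryHarnack.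
Proof: apply TP₂ to (p₁,p₂,p₃,p₄) = (t,b',b,c): Z(t,b)Z(b',c) ≤ Z(t,b')Z(b,c); Z(b,c) ≤ C_bubble (b
∼ c) and Z(b',c) ≥ x_c² (the 2-step SAW b'→b→c, b' ≠ c by the disjointness hypothesis), with x_c > 0
from Literature.Probability.RandomPlanarGeometry.SAW.criticalFugacity_pos_lt_one and the PROVED
LawlerSchrammWerner2004SAW_connectiveConstant_bounds_holds; take C := C_bubble / x_c². [difficulty:
provable-now] [Literature.Probability.RandomPlanarGeometry.SAW.criticalFugacity_pos_lt_one,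
Literature.Probability.RandomPlanarGeometry.SAW.weight_singleton, MadrasSlade1993]
#9 SAWTraversalBound (support) — the Aizenman–Burchard hypothesis (H1) for the critical
square-lattice SAW, standalone (verbatim the shared item stmt-CriticalPhenomena-1880 of route
SAWLeftRightFKG): per Dobrushin domain and endpoint approximation a shell-dependent threshold
k(x,ρ,R), K ≥ 0, λ > 2, δ₀ > 0 with SAW.law(k(x,ρ,R) separate traversals of D(x;ρ,R)) ≤ K(ρ/R)^λ for
δ ∈ (0,δ₀], δ ≤ ρ < R ≤ 1. [difficulty: open-problem] [AizenmanBurchardDuke1999,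
KemppainenSmirnov2017, Literature.Probability.Percolation.bondExploration_traversalBound]
#9 EventualTight (support) — eventual tightness of the critical SAW laws (verbatim shared item
stmt-CriticalPhenomena-1881): IsTightAlongMesh of δ ↦ (SAW.law D δ a_δ b_δ, γ ↦ γ.curve) — the
repaired form of the refuted all-δ Tight (stmt-CriticalPhenomena-0772). [difficulty: open-problem]
[Literature.Probability.RandomPlanarGeometry.IsTightAlongMesh, AizenmanBurchardDuke1999,
KemppainenSmirnov2017,
Summit.CriticalPhenomena.SAWScalingLimit.Theorems.SAWParafermionTight_refuted]
#9 TraversalBoundTight (support) — glue SAWTraversalBound → EventualTight by the tree's PROVED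
Aizenman–Burchard criterion
Literature.Probability.RandomPlanarGeometry.isTightMeasureSet_of_traversalBounds (H0 = a SAW uses
each lattice edge once) and isTightAlongMesh_of_isTightMeasureSet_image (verbatim shared item
stmt-CriticalPhenomena-1882). [difficulty: provable-now]
[Literature.Probability.RandomPlanarGeometry.isTightMeasureSet_of_traversalBounds,
Literature.Probability.RandomPlanarGeometry.isTightAlongMesh_of_isTightMeasureSet_image,
AizenmanBurchardDuke1999]

TWO-LAYER PLAN. Foreseen glued splits (none filed now): TPToTraversalBound ⇐ HarnackToG2
(BoundaryHarnack ∧ reverse Simon–Lieb ⇒ an unforced dyadic-annulus crossing in a slit domain has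
conditional probability ≤ 1−ε) → G2ToTraversalBound (iterate over scales, KS/AB bookkeeping) →
TPToTraversalBound; BoundaryTP2 ⇐ TP2Rectangles (strips/rectangles, where Cauchy–Binet reduces TP₂
to 2-positivity of the transfer operator) → TP2SlitDomains (general simply connected domains by a
re-pairing injection at the first common vertex, many-to-one bookkeeping) → BoundaryTP2;
CriticalBubbleBound ⇐ HalfPlaneBubble (arch generating function between adjacent boundary points
finite) → BulkFromBoundary → CriticalBubbleBound.

KILL CRITERIA. ¬BoundaryTP2 by ONE certified quadruple at x_c (μ ∈ [2.6, 2.7] is proved in tree; the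
margin must exceed the x_c-uncertainty, so a witness needs a domain where the violation is not a
1e-6 bottleneck effect, or sharper μ bounds) closes the route `refuted:BoundaryTP2` — unless the
witness is a typing artefact of the interlacing hypotheses (a configuration that is not four
outer-boundary points in cyclic order), in which case tenure restates once with the intended
proviso. ¬CircularTPAll has OCCURRED numerically (negative separated minors of order rows + 1 on
strip rectangles, certified by refuter rreview-6d2977b1; formal ¬-theorem not filed): as announced
at open it kills only the electrical-shadow/transfer-operator programme — the item was dropped (rev
5) and the assembly never used it. ¬CriticalBubbleBound (G_{z_c}(0,e₁) = ∞) voids TPToHarnack's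
constant and forces scale-dependent bubbles in TPToTraversalBound — a pivot (restate (E) without
(B)), not a close. ¬SAWTraversalBound or ¬EventualTight refutes precompactness for that
approximation and hence the conjunct as typed (all routes); ¬SubseqIdentification kills the
conjunct. EventualTight proved elsewhere moots (E) but not (TP)'s standalone value.

NOT DECOMPOSED YET. The RSW scheme inside TPToTraversalBound (which annuli, how Kesten's identity
Σ_T a_T(x_c) = 1 and D₄ symmetry give ε on ℤ², interior endpoints of IsEndpointApprox via first-step
conditioning) — layer-2 children later; reverse Simon–Lieb and MLR/target-switching monotonicity as
separate decls (they are relabellings of BoundaryTP2; provers attach them with --supports); the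
one-sided Karlin–McGregor sandwich 0 ≤ det ≤ Z^{(2)}_avoid (card; 60/60 in its tests) — not filed
until BoundaryTP2 has a proof idea; the CIM shadow network N_δ and Conjecture ES (homogenisation to
the conductivity (Im φ_D)^{3/4}, boundary operator (−Δ_∂)^{1/8}) — needs definitions of circular
planar networks / response matrices and is a reformulation of kernel scaling, deliberately NOT
requested at open and now moot on strips (order-(rows+1) minors negative); x < x_c versions of TP (a
subcritical TP₂ — TP₂ in every domain at every x < x_c — would give BoundaryTP2 by continuity, each
minor being a polynomial in x; not filed until someone has a subcritical mechanism); TP on the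
hexagonal lattice. DROPPED rev 8 (unused-crux repair), not refuted: EdgeOfPositivity
(stmt-CriticalPhenomena-11344, card Conjecture E — for every x > x_c some bounded simply connected
domain carries an interlaced, disjointly-realisable quadruple at which TP₂ FAILS strictly for the
weights x^{|γ|}). Conjecture-grade statements are crux-only (kind.auto-crux, 2026-08-16) and a crux
must feed `closes`; E cannot: its logical form bounds the TP₂-threshold sup{x : TP₂ holds in every
domain} from ABOVE by x_c, while `closes` needs TP₂ AT x_c (BoundaryTP2) — no true implication from
E (alone or with the other items) to any hypothesis of `closes` exists short of a costume split
("TP₂ at some x ≥ x_c" ∧ E), so no glue item was filed. E keeps its standing as Conjecture E of card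
totally-positive-polymer (with BoundaryTP2: x_c = max{x : TP₂ holds in every domain}, a μ-free
sign-theoretic characterisation of the connective constant) together with its record: thresholds
x₀(L) = 0.501, 0.475, 0.457, 0.444, 0.435, 0.427 on L×L boxes (L = 4..9, exact DP, refuter
cdisprove-10687: x₀(L) ≈ x_c + 0.9·L^{-4/3}, corner quadruples), violations down to x = 0.435 on the
6×14 strip, no plateau seen; certified facts landed sorry-free under
Summits/CriticalPhenomena/SAWScalingLimit/Theorems/EdgeOfPositivity/Negative/
(EdgeOfPositivityWindow: one 2×3 box witnesses every x ≥ 0.551; EdgeOfPositivityBoxCertificates: the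
ray x ≥ 0.542 with the 3×3 midpoint certificate, the 2×2 box is tight at x = 1 and never violates,
and violation sets of a fixed quadruple are NOT up-sets in x (not_upset_24) — so nothing about TP₂
transfers between fugacities by monotonicity; EdgeOfPositivityLoadBearing: x_c < x is load-bearing,
x = 0 has no witness; EdgeOfPositivityRectDomain: rectangles are bounded simply connected lattice
domains with a proved-complete kernel path enumerator — reusable by BoundaryTP2 / TPToHarnack
provers and refuters); crux workfiles (7 ideas, 3 skeleton lines neck-chain / rectangle-windows /
supercritical-dumbbell-pinch, Disproof.lean, triage) stay under
Summits/CriticalPhenomena/SAWScalingLimit/Cruxes/EdgeOfPositivity/. It is to be re-filed only by a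
route whose deciding theorem consumes it.

CHEAPEST FALSIFIER. Exact enumeration of the boundary kernel on small domains: exp/tp2_domains.py in
this planner folder (pure python; every domain ≤ 38 sites runs in < 10 s) — RUN this session on 20
domains (boxes 3×3…6×6, L-shapes 5×5−2×2, 6×5−3×2, 6×6−3×3, 7×6−3×3, slit boxes 5×4…7×6 with slit
depth 2–5): TP₂ at x_c has ZERO violations (100 000+ quadruples), also on the whole proved interval
x ∈ [1/2.7, 1/2.6]; separated TP₃ holds on boxes and L-shapes but FAILS at slit mouths (−1e-4
relative); on rectangles the refuter's certified scan (82 exhaustive TP₂ checks, 0 violations;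
minors to k = 5) then found the order-(rows+1) minors NEGATIVE on 3- and 4-row strips —
CircularTPAll dropped, BoundaryTP2 unrefuted. Next rung for refuters: a transfer-matrix version (cut
states = non-crossing partial pairings) for L×L and L×mL boxes, L ≤ 12, and slit boxes of depth ≥ 6,
scanning all 2×2 minors at x_c with interval arithmetic; one certified negative 2×2 circular minor
kills BoundaryTP2. (kit compute was unavailable this session: compute.sock absent.)

NUMBERS. x_c = 1/μ = 0.3790522777 (μ = 2.63815853); proved in tree: 2.6 ≤ μ ≤ 2.7
(LawlerSchrammWerner2004SAW_connectiveConstant_bounds_holds). TP₂ first-violation thresholds x₀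
(this session; card in brackets): box 3×3 0.540, 4×3 0.522, 4×4 0.501 [0.501], 5×4 0.489, 5×5
[0.475], 6×5 0.467, 6×6 0.458 [0.457], 7×6 [0.451]; slit 5×4 0.480, slit 5×5 0.470/0.479, slit 6×5
0.469, slit 6×6 0.468, slit 7×4 0.471; L 5×5 0.477, L 6×5 0.475, L 6×6 0.474, L 7×6 0.464. Worst TP₂
margins at x_c (min over quadruples of non-crossing/crossing − 1): boxes 4×4 +4.2e-2, 5×4 +2.5e-2,
6×5 +1.3e-2, 6×6 +1.1e-2; L-shapes +6.2e-3, +3.5e-3, +1.8e-3, +1.9e-3 (7×6); slit mouths +2.6e-4 …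
+8.9e-7 (decaying geometrically with slit depth 2→5, positive throughout [0.30, 0.3846]). Separated
3×3 minors at x_c: boxes 5×4 (27) worst +8.3e-3, 6×5 (2052) +1.2e-3, 6×6 (7572) +5.6e-4; L 5×5 (342)
+7.7e-5, L 6×5 (1644) +1.2e-5, L 6×6 (5997) +3.8e-6, L 7×6 (17604) +3.7e-6; slit 6×5: 16/9546
NEGATIVE (worst −8.8e-5), slit 7×4: 186/6216 negative (−1.1e-4), slit 6×6: 1024/53034 negative
(−9.8e-5). Boundary exponent bookkeeping: h = 5/8, 2h = 5/4, s = h − 1/2 = 1/8, CS weight 1 − 2s =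
3/4. Refuter's certified negatives (stmt-7118 evidence): k = 4 minor on the 7×3 grid at x_c =
−1.10e−8 (relative −4e−5), negative on all of [1/2.7, 1/2.6]; k = 5 on 10×4 = −4.19e−11 (relative
−1.0e−6). Items at open: 12; after rev 5: 11 (4 cruxes ranked 2, 3, 4, 6; 6 support; 1 assembly);
rev 6 (cone repair): EdgeOfPositivity re-typed barrier-free 1:1, extra imports 3 → 2
(SLEConvergenceCriterion for IsTightAlongMesh, CurveTortuosity for Curve.HasTraversals; both carry
only predicates and proved lemmas, no named facts). Rev 7: EdgeOfPositivity auto-promoted support →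
crux (conjecture-grade). Rev 8 (unused-crux repair): EdgeOfPositivity dropped — items 11 → 10: 4
cruxes (ranked 2, 3, 4, 6: BoundaryTP2, TPToTraversalBound, CriticalBubbleBound,
SubseqIdentification), 5 support (SAWTraversalBound, EventualTight, TraversalBoundTight — proved,
BoundaryHarnack, TPToHarnack), 1 assembly; `closes` unchanged (6 hypotheses = BoundaryTP2,
CriticalBubbleBound, TPToTraversalBound, TraversalBoundTight, SubseqIdentification, Assembly →
SAWScalingLimit); every declared crux now lies in the cone of `closes`.

DEFINITION REQUESTS. None: every statement is typed over
Literature.Probability.RandomPlanarGeometry.SAW.DomainSAW / SAW.weight / SAW.law /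
SAW.criticalFugacity, Curve.HasTraversals, IsTightAlongMesh, IsSLELaw and Mathlib
(SimplyConnectedSpace, List.Disjoint, tsum, ENNReal.ofReal); no Literature.Barriers module is
imported (the only fugacity-x statement, EdgeOfPositivity, typed its weight Σ_γ x^{|γ|} inline and
was dropped in rev 8; every remaining item lives at x = x_c). None foreseen either: the
electrical-shadow definitions (CircularPlanarNetwork / responseMatrix, Kenyon–Wilson
doi:10.1137/140997798 §2) are moot after the order-(rows+1) negatives on strips.

Novelty: Searches (2026-08-15): `lit search --hybrid "critical two-point function self-avoiding walk finite"`
(12 docs; MadrasSlade1993 p.22 read: finiteness open in d=2,3,4); `lit search --source crossref`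
"Ising model total positivity" (8; Lis 2016 found), "Circular planar graphs resistor networks" (5),
"space of circular planar electrical networks" (5), "self-avoiding walks non-intersecting pairs
partition function inequality planar" (8, none relevant), "upper bound number of self-avoiding
polygons via joining" (6; Hammond 2018/2019); `lit search --source zbmath` "self-avoiding walk total
positivity" (0), "SAW correlation inequality non-crossing pairs boundary points" (0); `lit galaxy
search "critical two-point function is finite" --star all` (1: MS93); `lit frontier
CriticalPhenomena --since 2020` (30 rows: arXiv:2605.30299 reverses Simon–Lieb for high-d
PERCOLATION, arXiv:2603.28161 CLE boundary 4-point connectivities — neither about SAW kernels); plus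
the card's galaxy queries ('totally positive', 'Karlin-McGregor': no polymer hit) and the novelty
auditor's ('Ising model and total positivity').
Nearest prior art found: doi:10.1007/s10955-016-1690-x (Lis 2016/17: planar-Ising boundary spin
correlations are circular-TP, via alternating flows on random currents) and
doi:10.1215/00127094-2019-0086 (Galashin–Pylyavskyy: Ising boundary correlations = OG≥0) — the n =
1, Pfaffian sibling; Fomin2001 and KarlinMcgregor1959 — the Markovian equality case det =
non-intersection weight; doi:1  [refs: 10.1007/s10955-016-1690-x, 10.1215/00127094-2019-0086, 10.1016/s0024-3795(98, 10.1137/140997798, 2605.30299, 2603.28161, doi:10.1007/s10955-016-1690-x, doi:10.1215/00127094-2019-0086, doi:10.1016/s0024-3795, doi:10.1137/140997798, MadrasSlade1993, Fomin2001, KarlinMcgregor1959]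

Barriers (technique_class: total-positivity, circular-minors, boundary-harnack): - technique_class: total-positivity, circular-minors, boundary-harnack
- Literature.Barriers.CriticalPhenomena.EmbeddingModulusUniqueness: TP, the bubble and Harnack are
embedding-blind (they hold verbatim on a sheared lattice, whose limit kernel is the sheared H^{5/8},
still TP), so this line can never produce rotation or conformal invariance — EVADED BY SCOPE: it
delivers precompactness (EventualTight) and typed a-priori inequalities and IMPORTS identification
(SubseqIdentification, embedding-sensitive routes SAWParafermion / SAWConfRestriction /
SAWRestrictionRigidity / SAWHexUniversality); honest residue: without (I) the route proves eventual
tightness and boundary Harnack, not the conjunct.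
- Literature.Barriers.CriticalPhenomena.SupercriticalSAWSpaceFilling: RESPECTED — TP is asserted at
x = x_c only; its sharpness companion (card Conjecture E: TP₂ FAILS somewhere for every x > x_c;
enumeration thresholds x₀(L) ↓ 0.54 → 0.43 for L = 3..9, certified failure ray x ≥ 0.542 in
Theorems/EdgeOfPositivity/Negative/) is recorded on the card and in Cruxes/EdgeOfPositivity, no
longer filed as an item (EdgeOfPositivity dropped rev 8: conjecture-grade and not load-bearing for
`closes`); nothing filed is an open condition in x (violation sets are not even monotone in x:
not_upset_24), RobustSAWScalingLimit is not entailed.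
- Literature.Barriers.CriticalPhenomena.SAWNotKineticallyGrown: no growth rule or one-step
consistency is used; only the configurational x_c^{|γ|} weights, their

History (route lifecycle, newest last):
- 2026-08-15T16:21:09Z · rev 1: restated TPToTraversalBound (stmt-CriticalPhenomena-7116) — route-repair (glue): re-materialise TPToTraversalBound — it carried a stale blocked_missing_decls flag from open-time materialisation order and was rendered as (planner-rbadge-CriticalPhenomena-SAWTotalPosit-e46d5ac9-g2-0)
- 2026-08-15T16:23:47Z · rev 3: restated Assembly (stmt-CriticalPhenomena-7122) — route-repair (glue): re-materialise Assembly — stale blocked_missing_decls (TPToTraversalBound, open-time order) had it rendered as a TODO comment; same proposi (planner-rbadge-CriticalPhenomena-SAWTotalPosit-e46d5ac9-g2-0)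
- 2026-08-15T16:58:57Z · rev 5: dropped CircularTPAll — drop CircularTPAll (stmt-CriticalPhenomena-7118): certified FALSE as typed and not load-bearing — refuter rreview-6d2977b1's exact-arithmetic witnesses on the i (planner-rbadge-CriticalPhenomena-SAWTotalPosit-e46d5ac9-g2-0)
- 2026-08-15T17:08:29Z · rev 6: restated EdgeOfPositivity (stmt-CriticalPhenomena-7119) — route-repair (cone): re-route around the barrier import — EdgeOfPositivity (support, stmt-CriticalPhenomena-7119, not a hypothesis of `closes`) was the only ite (planner-rrepair-CriticalPhenomena-SAWTotalPosi-e46d5ac9-0)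
- 2026-08-16T02:18:12Z · AUTO-CRUX: 1 conjecture-grade item(s) promoted to crux (EdgeOfPositivity) — refuter vetting / tiering apply (operator:999:1362873)
- 2026-08-16T06:20:31Z · rev 8: dropped EdgeOfPositivity — route-repair (unused-crux): drop EdgeOfPositivity (stmt-CriticalPhenomena-11344) — auto-promoted support→crux as conjecture-grade (rev 7) but outside the cone o (planner-rrepair-CriticalPhenomena-SAWTotalPosi-7778876e-0)
- 2026-08-26T05:02:35Z · DORMANT — reconciler: no traction for 8.4 d (last activity item-evidence-added at 2026-08-17T19:24:59Z); parked, not closed — `ledger route dormant route-CriticalPhenomen (operator:999:1806378)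

sub-problem: SAWScalingLimit · status: dormant · opened planner-plancard-CriticalPhenomena-SAWScaling-8d5a7f2d-0 2026-08-15T12:02:52Z · rev 9 · ledger route-CriticalPhenomena-SAWTotalPositivity
GENERATED by the gate from the ledger (D-0016/17). Provers cite these decls: `theorem foo : Summit.CriticalPhenomena.SAWScalingLimit.Theses.SAWTotalPositivity.<Decl> := …` in Summits/CriticalPhenomena/SAWScalingLimit/Theorems/<Name>.lean.
-/

namespace Summit.CriticalPhenomena.SAWScalingLimit.Theses.SAWTotalPositivity

open scoped BigOperators Topology Manifold Classical MeasureTheory ProbabilityTheory Matrix InnerProductSpace ComplexConjugate ContinuousMap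
open Filter Set Function TopologicalSpace MeasureTheory

attribute [summit_statement] _root_.SAWScalingLimit

/-- item stmt-CriticalPhenomena-7115 · crux · rank 2 · open · by planner
why it might fail: Enumeration evidence only (card: boxes ≤ 7×6; here 20 domains ≤ 38 sites incl. L-shapes and slit boxes, 0 violations); across a bottleneck the 2×2 block is nearly rank one and the x_c-margin decays geometrically with slit depth (2e-5, 4e-6, 9e-7 at depth 3,4,5); no switching lemma is known.
sources: Summits/CriticalPhenomena/SAWScalingLimit/Ideas/totally-positive-polymer.md, doi:10.1007/s10955-016-1690-x, doi:10.1215/00127094-2019-0086, Fomin2001, KarlinMcgregor1959, MadrasSlade1993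
[crux] circular TP₂ of the critical SAW boundary kernel (card Conjecture TP, order 2): for every
bounded simply connected Ω ⊂ ℂ, δ > 0 and lattice points p₁,p₂,p₃,p₄ of Ω_δ such that every SAW
p₁→p₃ meets every SAW p₂→p₄ (interlacing) while the pairings (p₁p₂|p₃p₄) and (p₁p₄|p₂p₃) are
realisable by vertex-disjoint SAWs, Z(p₁,p₃)·Z(p₂,p₄) ≤ Z(p₁,p₂)·Z(p₃,p₄) (Z = SAW.weight … univ at
x_c). The other non-crossing inequality, reverse Simon–Lieb and boundary Harnack are instances by
relabelling. [difficulty: L] -/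
@[route_item "route-CriticalPhenomena-SAWTotalPositivity", crux]
def BoundaryTP2 : Prop :=
  ∀ (Ω : Set ℂ) (δ : ℝ) (p₁ p₂ p₃ p₄ : Literature.Probability.LatticeModels.Site 2), Bornology.IsBounded Ω → SimplyConnectedSpace Ω → 0 < δ → (∀ (P : Literature.Probability.RandomPlanarGeometry.SAW.DomainSAW Ω δ p₁ p₃) (Q : Literature.Probability.RandomPlanarGeometry.SAW.DomainSAW Ω δ p₂ p₄), ∃ v, v ∈ P.walk.support ∧ v ∈ Q.walk.support) → (∃ (P : Literature.Probability.RandomPlanarGeometry.SAW.DomainSAW Ω δ p₁ p₂) (Q : Literature.Probability.RandomPlanarGeometry.SAW.DomainSAW Ω δ p₃ p₄), List.Disjoint P.walk.support Q.walk.support) → (∃ (P : Literature.Probability.RandomPlanarGeometry.SAW.DomainSAW Ω δ p₁ p₄) (Q : Literature.Probability.RandomPlanarGeometry.SAW.DomainSAW Ω δ p₂ p₃), List.Disjoint P.walk.support Q.walk.support) → Literature.Probability.RandomPlanarGeometry.SAW.weight Ω δ p₁ p₃ Set.univ * Literature.Probability.RandomPlanarGeometry.SAW.weight Ω δ p₂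 p₄ Set.univ ≤ Literature.Probability.RandomPlanarGeometry.SAW.weight Ω δ p₁ p₂ Set.univ * Literature.Probability.RandomPlanarGeometry.SAW.weight Ω δ p₃ p₄ Set.univ

-- earlier TPToTraversalBound (stmt-CriticalPhenomena-7116, replaced 2026-08-15T16:21:09Z -> stmt-CriticalPhenomena-10687): retired by None — BoundaryTP2 → (∃ C : ENNReal, C ≠ ⊤ ∧ ∀ (Ω : Set ℂ) (δ : ℝ) (u v : Literature.Probability.LatticeModels.Site 2), Bornology.IsBounded Ω → 0 < δ → (Literature.Probability.LatticeModels.zdGraph 2).Adj u v → Literature.Probability.RandomPlanarGeometry.SAW.weight Ω 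
/-- item stmt-CriticalPhenomena-10687 · crux · rank 3 · open · by planner
why it might fail: TP yields two-polymer cross-ratio inequalities and O(1) boundary gluing only; the ε against unforced annulus crossings needs a scale-invariant bound comparing boundary-hugging with annulus-crossing partition functions — the RSW gap (KS G2 unverified for SAW, false for κ>4 analogues).
sources: AizenmanBurchardDuke1999, KemppainenSmirnov2017, Kesten1963SAW, MadrasSlade1993, KohlerSchindlerTassion2023, DuminilCopinHammond2013
[crux] the engine run — BoundaryTP2 → CriticalBubbleBound → SAWTraversalBound: cross-ratio
positivity of the boundary kernel in every slit domain (domain Markov: the future of the chordal SAW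
is the x_c-SAW of the slit graph from a boundary tip) plus one bubble constant give the
Aizenman–Burchard hypothesis (H1) — a shell-dependent threshold k(x,ρ,R), K, λ > 2, δ₀ with P_δ(k
separate traversals of D(x;ρ,R)) ≤ K(ρ/R)^λ. Scheme: reverse Simon–Lieb lower gluing along the
boundary of the slit domain + Simon–Lieb upper splitting at annulus crossings + Kesten's bridge-mass
identity at x_c and D₄ symmetry for the scale-invariant ε, iterated over dyadic annuli; endpoint
bookkeeping as in Literature.Probability.Percolation.bondExploration_traversalBound. [deps:
BoundaryTP2, CriticalBubbleBound] [difficulty: XL] -/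
@[route_item "route-CriticalPhenomena-SAWTotalPositivity", crux]
def TPToTraversalBound : Prop :=
  BoundaryTP2 → (∃ C : ENNReal, C ≠ ⊤ ∧ ∀ (Ω : Set ℂ) (δ : ℝ) (u v : Literature.Probability.LatticeModels.Site 2), Bornology.IsBounded Ω → 0 < δ → (Literature.Probability.LatticeModels.zdGraph 2).Adj u v → Literature.Probability.RandomPlanarGeometry.SAW.weight Ω δ u v Set.univ ≤ C) → (∀ (D : Literature.Probability.RandomPlanarGeometry.DobrushinDomain) (a b : ℝ → Literature.Probability.LatticeModels.Site 2), Literature.Probability.RandomPlanarGeometry.SAW.IsEndpointApprox D a b → ∃ (k : ℂ → ℝ → ℝ → ℕ) (K lam δ₀ : ℝ), 0 ≤ K ∧ 2 < lam ∧ 0 < δ₀ ∧ ∀ δ : ℝ, δ ∈ Set.Ioc (0 : ℝ) δ₀ → ∀ (x : ℂ) (ρ R : ℝ), δ ≤ ρ → ρ < R → R ≤ 1 → Literature.Probability.RandomPlanarGeometry.SAW.law D.carrier δ (a δ) (b δ) {γ | (⟨γ.walk.toCurve (Literature.Probability.LatticeModels.meshPoint δ)⟩ : Literature.Probability.RandomPlanarGeometry.Curve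 ℂ).HasTraversals (k x ρ R) x ρ R} ≤ ENNReal.ofReal (K * (ρ / R) ^ lam))

/-- item stmt-CriticalPhenomena-7117 · crux · rank 4 · open · by planner
why it might fail: In substance G_{z_c}(0,e₁)<∞ on ℤ², open since Madras–Slade 1993 p.22 ("not yet proved that G_{z_c}(0,x) is even finite for d=2,3,4"); Hammond (doi:10.1214/17-aop1182) gives p_n ≤ n^{-3/2+o(1)}μ^n on a density-one set, short of Σ_n n·p_n·μ^{-n} < ∞ (truth: n^{-5/2}).
sources: MadrasSlade1993, doi:10.1214/17-aop1182, doi:10.1214/14-aop993, BDGS2012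
[crux] finiteness of the critical bubble in d = 2: there is C < ∞ with Z_Ω(u,v) = SAW.weight Ω δ u v
univ ≤ C for every bounded Ω ⊂ ℂ, δ > 0 and lattice-adjacent u ∼ v (equivalently, by monotone
exhaustion, G_{z_c}(0,e₁) < ∞ on ℤ²). It is the absolute constant in reverse Simon–Lieb Z(a,b) ≥
Z(a,c⁺)Z(c⁻,b)/Z(c⁻,c⁺) and in TPToHarnack. [difficulty: open-problem] -/
@[route_item "route-CriticalPhenomena-SAWTotalPositivity", crux]
def CriticalBubbleBound : Prop :=
  ∃ C : ENNReal, C ≠ ⊤ ∧ ∀ (Ω : Set ℂ) (δ : ℝ) (u v : Literature.Probability.LatticeModels.Site 2), Bornology.IsBounded Ω → 0 < δ → (Literature.Probability.LatticeModels.zdGraph 2).Adj u v → Literature.Probability.RandomPlanarGeometry.SAW.weight Ω δ u v Set.univ ≤ C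

/-- item stmt-CriticalPhenomena-0783 · crux · rank 6 · open · by planner
why it might fail: Unconditional over arbitrary subsequential μ: SLE_{8/3} is known only IF the limit is conformally covariant (LSW04 Prediction 1); on ℤ² no embedding-sensitive input exists (observable open even on Hex); embedding-blind inputs incl. TP cannot give rotations (Beffara).
sources: LawlerSchrammWerner2004SAW, LawlerSchrammWerner2003Restriction, DuminilCopinSmirnov2012, Beffara2008Universal, Literature.Barriers.CriticalPhenomena.EmbeddingModulusUniqueness
[crux] r3: identification of subsequential limits — for every Dobrushin domain D, endpoint
approximation (a_δ,b_δ), sequence s_n → 0+ and probability measure μ on CurveClass ℂ, if ∫ f∘curve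
d(Literature.Probability.RandomPlanarGeometry.SAW.law D (s n) …) → ∫ f dμ for all bounded continuous
f then μ is the chordal SLE_{8/3} law in D (Literature.Probability.RandomPlanarGeometry.IsSLELaw
(8/3) D μ). Obtained from r2 (observable limit) by the martingale principle (LSW03
arXiv:math/0209343 Prop. 5.2: κ = 8/3 is singled out by the 5/8-observable), or from restriction
(sibling route). -/
@[route_item "route-CriticalPhenomena-SAWTotalPositivity", crux]
def SubseqIdentification : Prop :=
  ∀ (D : Literature.Probability.RandomPlanarGeometry.DobrushinDomain) (a b : ℝ → Literature.Probability.LatticeModels.Site 2), Literature.Probability.RandomPlanarGeometry.SAW.IsEndpointApprox D a b → ∀ (s : ℕ → ℝ) (μ : MeasureTheory.Measure (Literature.Probability.RandomPlanarGeometry.CurveClass ℂ)), Filter.Tendsto s Filter.atTop (nhdsWithin 0 (Set.Ioi 0)) → MeasureTheory.IsProbabilityMeasure μ → (∀ f : BoundedContinuousFunction (Literature.Probability.RandomPlanarGeometry.CurveClass ℂ) ℝ, Filter.Tendsto (fun n => ∫ γ, f γ.curve ∂(Literature.Probability.RandomPlanarGeometry.SAW.law D.carrier (s n) (a (s n)) (b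 (s n)))) Filter.atTop (nhds (∫ x, f x ∂μ))) → Literature.Probability.RandomPlanarGeometry.IsSLELaw ((8 : NNReal) / 3) D μ

/-- item stmt-CriticalPhenomena-1880 · support · rank 9 · open · by planner
sources: AizenmanBurchardDuke1999, KemppainenSmirnov2017, Literature.Probability.Percolation.bondExploration_traversalBound
[support] the Aizenman–Burchard hypothesis (H1) for the critical square-lattice SAW, standalone form
of r3's conclusion (so that other tightness routes — e.g. card saw-rsw-from-kesten-renewal-tightness
— can share it, and a direct proof by any method closes r3 too): for every Dobrushin domain D and
endpoint approximation (a_δ, b_δ) there exist a shell-dependent threshold k : ℂ → ℝ → ℝ → ℕ, K ≥ 0,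
λ > 2, δ₀ > 0 such that for δ ∈ (0, δ₀] and δ ≤ ρ < R ≤ 1,
Literature.Probability.RandomPlanarGeometry.SAW.law D δ a_δ b_δ {γ : the mesh polyline of γ has
k(x,ρ,R) separate traversals of D(x;ρ,R)} ≤ K(ρ/R)^λ
(Literature.Probability.RandomPlanarGeometry.Curve.HasTraversals). Shape copied from
Literature.Probability.Percolation.bondExploration_traversalBound (which is PROVED for percolation
in InterfaceTraversalBound.lean). -/
@[route_item "route-CriticalPhenomena-SAWTotalPositivity"]
def SAWTraversalBound : Prop :=
  ∀ (D : Literature.Probability.RandomPlanarGeometry.DobrushinDomain) (a b : ℝ → Literature.Probability.LatticeModels.Site 2), Literature.Probability.RandomPlanarGeometry.SAW.IsEndpointApprox D a b → ∃ (k : ℂ → ℝ → ℝ → ℕ) (K lam δ₀ : ℝ), 0 ≤ K ∧ 2 < lam ∧ 0 < δ₀ ∧ ∀ δ ∈ Set.Ioc (0 : ℝ) δ₀, ∀ (x : ℂ) (ρ R : ℝ), δ ≤ ρ → ρ < R → R ≤ 1 → Literature.Probability.RandomPlanarGeometry.SAW.law D.carrier δ (a δ) (b δ) {γ | (⟨γ.walk.toCurve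 (Literature.Probability.LatticeModels.meshPoint δ)⟩ : Literature.Probability.RandomPlanarGeometry.Curve ℂ).HasTraversals (k x ρ R) x ρ R} ≤ ENNReal.ofReal (K * (ρ / R) ^ lam)

/-- item stmt-CriticalPhenomena-1881 · support · rank 9 · open · by planner
sources: Literature.Probability.RandomPlanarGeometry.IsTightAlongMesh, AizenmanBurchardDuke1999, KemppainenSmirnov2017, Summit.CriticalPhenomena.SAWScalingLimit.Theorems.SAWParafermionTight_refuted
[support] EVENTUAL TIGHTNESS of the critical SAW laws: for every Dobrushin domain and endpoint
approximation, IsTightAlongMesh (fun δ γ => γ.curve) (fun δ => SAW.law D δ a_δ b_δ) — for every ε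
some compact set of CurveClass ℂ carries all but ε of the mass for all small δ. This is the form the
Prokhorov criterion convergesInLawToSLE_of_isTightAlongMesh consumes and the repair of the refuted
all-δ Tight (IsTightLaws over δ ∈ (0,1]) suggested by the refuting theorem; offered to routes
SAWParafermion / SAWConfRestriction as their restated r3/r4. -/
@[route_item "route-CriticalPhenomena-SAWTotalPositivity"]
def EventualTight : Prop :=
  ∀ (D : Literature.Probability.RandomPlanarGeometry.DobrushinDomain) (a b : ℝ → Literature.Probability.LatticeModels.Site 2), Literature.Probability.RandomPlanarGeometry.SAW.IsEndpointApprox D a b → Literature.Probability.RandomPlanarGeometry.IsTightAlongMesh (fun δ (γ : Literature.Probability.RandomPlanarGeometry.SAW.DomainSAW D.carrier δ (a δ) (b δ)) => γ.curve) (fun δ => Literature.Probability.RandomPlanarGeometry.SAW.law D.carrier δ (a δ) (b δ))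

/-- item stmt-CriticalPhenomena-1882 · support · rank 9 · closed · proved by Summit.CriticalPhenomena.SAWScalingLimit.Theorems.TraversalBoundTight_proof (prover) · by planner
sources: Literature.Probability.RandomPlanarGeometry.isTightMeasureSet_of_traversalBounds, Literature.Probability.RandomPlanarGeometry.isTightAlongMesh_of_isTightMeasureSet_image, AizenmanBurchardDuke1999
[support] glue SAWTraversalBound → EventualTight by the tree's PROVED Aizenman–Burchard criterion
isTightMeasureSet_of_traversalBounds in E = ℂ with Λ = a closed ball containing D (d = 2,
exists_finset_card_le_cover_closedBall), T = Ioc 0 δ₀, X_δ γ = the mesh polyline of γ (whose class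
is γ.curve): (H0) short-distance cutoff — a SAW uses each lattice edge at most once and boundedly
many δ-edges meet closedBall x δ, so no shell of inner radius ≤ δ is traversed k₀ times (cf.
Percolation.bondExploration_shortDistanceCutoff); (H1) = SAWTraversalBound with threshold max k₀ (k
x ρ R); then isTightAlongMesh_of_isTightMeasureSet_image (a.e.-measurability is automatic, ⊤
σ-algebra: SAW.aemeasurable_curve). -/
@[route_item "route-CriticalPhenomena-SAWTotalPositivity", crux]
def TraversalBoundTight : Prop :=
  SAWTraversalBound → EventualTight

/-- `TraversalBoundTight` holds: proved by `Summit.CriticalPhenomena.SAWScalingLimit.Theorems.TraversalBoundTight_proof`. -/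
theorem TraversalBoundTight_holds : TraversalBoundTight := _root_.Summit.CriticalPhenomena.SAWScalingLimit.Theorems.TraversalBoundTight_proof

/-- item stmt-CriticalPhenomena-7120 · support · rank 9 · open · by planner
sources: KennedyLawler2013, Summits/CriticalPhenomena/SAWScalingLimit/Ideas/circle-bridge-screening.md, Summits/CriticalPhenomena/SAWScalingLimit/Ideas/constant-loss-saw-comparison.md
[support] the engine's typed output, shareable — tip-uniform boundary Harnack comparability of the
critical SAW kernel: one C < ∞ such that in every bounded simply connected lattice domain, for
consecutive domain-adjacent boundary points b' ∼ b ∼ c and every t with {t,b} interlacing {b',c}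
(non-crossing pairings disjointly realisable), Z(t,b) ≤ C·Z(t,b'). Moving the target one lattice
step costs O(1) uniformly in the source and in the domain (incl. slit domains with a fractal past):
the bounded-density input (BP)/G1/S2 of cards restriction-markov-rigidity, circle-bridge-screening,
constant-loss-saw-comparison. [difficulty: L] -/
@[route_item "route-CriticalPhenomena-SAWTotalPositivity"]
def BoundaryHarnack : Prop :=
  ∃ C : ENNReal, C ≠ ⊤ ∧ ∀ (Ω : Set ℂ) (δ : ℝ) (t b b' c : Literature.Probability.LatticeModels.Site 2), Bornology.IsBounded Ω → SimplyConnectedSpace Ω → 0 < δ → (Literature.Probability.LatticeModels.discreteDomainGraph Ω δ).Adj b' b → (Literature.Probability.LatticeModels.discreteDomainGraph Ω δ).Adj b c → (∀ (P : Literature.Probability.RandomPlanarGeometry.SAW.DomainSAW Ω δ t b) (Q : Literature.Probability.RandomPlanarGeometry.SAW.DomainSAW Ω δ b' c), ∃ v, v ∈ P.walk.support ∧ v ∈ Q.walk.support) → (∃ (P : Literature.Probability.RandomPlanarGeometry.SAW.DomainSAW Ω δ t b') (Q : Literature.Probability.RandomPlanarGeometry.SAW.DomainSAW Ω δ b c),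 List.Disjoint P.walk.support Q.walk.support) → (∃ (P : Literature.Probability.RandomPlanarGeometry.SAW.DomainSAW Ω δ t c) (Q : Literature.Probability.RandomPlanarGeometry.SAW.DomainSAW Ω δ b' b), List.Disjoint P.walk.support Q.walk.support) → Literature.Probability.RandomPlanarGeometry.SAW.weight Ω δ t b Set.univ ≤ C * Literature.Probability.RandomPlanarGeometry.SAW.weight Ω δ t b' Set.univ

/-- item stmt-CriticalPhenomena-7121 · support · rank 9 · closed · proved by Summit.CriticalPhenomena.SAWScalingLimit.Theorems.tpToHarnack_proof (prover) · by planner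
sources: Literature.Probability.RandomPlanarGeometry.SAW.criticalFugacity_pos_lt_one, Literature.Probability.RandomPlanarGeometry.SAW.weight_singleton, MadrasSlade1993
[support] glue, provable now: BoundaryTP2 → CriticalBubbleBound → BoundaryHarnack. Proof: apply TP₂
to (p₁,p₂,p₃,p₄) = (t,b',b,c): Z(t,b)Z(b',c) ≤ Z(t,b')Z(b,c); Z(b,c) ≤ C_bubble (b ∼ c) and Z(b',c)
≥ x_c² (the 2-step SAW b'→b→c, b' ≠ c by the disjointness hypothesis), with x_c > 0 from
Literature.Probability.RandomPlanarGeometry.SAW.criticalFugacity_pos_lt_one and the PROVED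
LawlerSchrammWerner2004SAW_connectiveConstant_bounds_holds; take C := C_bubble / x_c². [difficulty:
provable-now] -/
@[route_item "route-CriticalPhenomena-SAWTotalPositivity"]
def TPToHarnack : Prop :=
  BoundaryTP2 → CriticalBubbleBound → BoundaryHarnack

-- `TPToHarnack` holds: proved by `Summit.CriticalPhenomena.SAWScalingLimit.Theorems.tpToHarnack_proof` (its module imports this route file, so no `_holds` link can be stated here).

-- earlier Assembly (stmt-CriticalPhenomena-7122, replaced 2026-08-15T16:23:47Z -> stmt-CriticalPhenomena-10783): retired by None — BoundaryTP2 → CriticalBubbleBound → TPToTraversalBound → TraversalBoundTight → SubseqIdentification → SAWScalingLimit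
/-- item stmt-CriticalPhenomena-10783 · assembly · rank 1 · closed · proved by Summit.CriticalPhenomena.SAWScalingLimit.Theorems.totalPositivity_assembly_proof @ 582e587ef5f7 (prover) · by planner
sources: Literature.Probability.RandomPlanarGeometry.convergesInLawToSLE_of_isTightAlongMesh, Literature.Probability.RandomPlanarGeometry.IsSLECurve.map_eq_holds, Literature.Probability.RandomPlanarGeometry.SAW.aemeasurable_curve, BillingsleyCPM1999
[assembly] BoundaryTP2 → CriticalBubbleBound → TPToTraversalBound → TraversalBoundTight →
SubseqIdentification → SAWScalingLimit. -/
@[route_item "route-CriticalPhenomena-SAWTotalPositivity", crux]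
def Assembly : Prop :=
  BoundaryTP2 → CriticalBubbleBound → TPToTraversalBound → TraversalBoundTight → SubseqIdentification → _root_.SAWScalingLimit

-- `Assembly` holds: proved by `Summit.CriticalPhenomena.SAWScalingLimit.Theorems.totalPositivity_assembly_proof` @ 582e587ef5f7 (its module imports this route file, so no `_holds` link can be stated here).

-- records of items no longer active in this route (dropped / restated):
-- earlier EdgeOfPositivity (stmt-CriticalPhenomena-7119, replaced 2026-08-15T17:08:29Z -> stmt-CriticalPhenomena-11344): retired by None — ∀ x : ℝ, Literature.Probability.RandomPlanarGeometry.SAW.criticalFugacity < x → ∃ (Ω : Set ℂ) (δ : ℝ) (p₁ p₂ p₃ p₄ : Literature.Probability.LatticeModels.Site 2), Bornology.IsBounded Ω ∧ SimplyConnectedSpace Ω ∧ 0 < δ ∧ (∀ (P : Literature.Probability.RandomPlanar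

/-! D-0027 §2.1 — DECIDING THEOREM (planner-authored via `route open/edit --closes-file`; by planner-rbadge-CriticalPhenomena-SAWTotalPosit-e46d5ac9-g2-0 2026-08-15T16:56:36Z):
its hypotheses are this route's items and its conclusion the sub-problem Statement (glue_lint), and it elaborates with this file. -/

@[closes "route-CriticalPhenomena-SAWTotalPositivity"] theorem closes : BoundaryTP2 → CriticalBubbleBound → TPToTraversalBound → TraversalBoundTight → SubseqIdentification → Assembly → _root_.SAWScalingLimit :=
  fun h_BoundaryTP2 h_CriticalBubbleBound h_TPToTraversalBound h_TraversalBoundTight h_SubseqIdentification h_Assembly =>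
    h_Assembly h_BoundaryTP2 h_CriticalBubbleBound h_TPToTraversalBound h_TraversalBoundTight h_SubseqIdentification

end Summit.CriticalPhenomena.SAWScalingLimit.Theses.SAWTotalPositivity
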